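import Literature.AlgebraicGeometry.AbelianSchemes.AbelianSchemeConstSubgroupQuotient
import Literature.AlgebraicGeometry.AbelianSchemes.AbelianSchemeDualTransport
import HarnessLib

/-!
# Re-origining the dual: the abstract `DualPair` does NOT pin the normalisation `(1_A × ε_Â)^*𝒫 ≅ 𝒪`
# (kernel record of FINDING 8aea22b3 of the `hodgecm-mathlib` cell, and the regression guard of its repair)

Layer `Literature/AlgebraicGeometry/AbelianSchemes`, namespace `Literature.AlgebraicGeometry.AbelianSchemes.AbelianSchemeOver(.DualPair)`.
Cell `hodgecm-mathlib` (D-0151), director s254 (1)(V3) / s254′ (ii) / s256 / s261 (1); author A-p04 (g19); finding B-p18 (g19)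
(memo `FINDING-8alpha-represents-unit-hypothesis` 8aea22b389a93226 §2(b)), read by B-p17 (g14) (V1), REF1 (g12) m38–m39 and
ref2 (g13) l09 (V2).  Three small definitions with bodies (`reOrigin` ×2, `sectionSlice`); theorems otherwise; no instance, no
notation, no named fact, no `sorry`.  No ★ statement is contradicted: the file exhibits, in the kernel, a letter drift of the
INTERFACE ★ `AbelianSchemeDualPair.DualPair` — [MilneAV2008, I §8]'s dual is a universal PAIR normalised along BOTH `ε_A × 1`
and `1 × ε_Â` ([MumfordFogartyKirwan1994, Ch. 6 §2 p. 121]); the structure records the first normalisation only, and its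
remaining fields (`fibrewisePicZero` at geometric points, `universal` with `∃!` on the MORPHISM) never read the group law of
`hat` — so «translating the group law of `hat` by a section gives another dual pair with the same `P`» (the NOTE of ★
`RigidifiedLineBundleTensor.nonempty_pullbackP_comp_unitSection_iso`), whose second normalisation FAILS.

* §1 `AbelianSchemeOver.reOrigin B σ` — the abelian scheme `B → S` with its group law TRANSPORTED along the translation
  `t_σ : B ≅ B` (Mathlib `GrpObj.ofIso`, ★ `translationIso`; same `Over S`-object, same structure map, properness / smoothness /
  connected geometric fibres untouched); its unit section is `σ` (`reOrigin_unitSection`); the slice `A × {σ}` (`sectionSlice`).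
* §2 **`DualPair.reOrigin D σ : A.DualPair`** — `hat := D.hat.reOrigin σ`, `P := D.P`, and ALL FOUR `Prop` fields
  (`hasRank_one`, `rigid`, `fibrewisePicZero`, `universal`) discharged BY `D`'S OWN FIELDS VERBATIM.  (The data `(Â_σ, 𝒫)` and
  the «translate» `(Â, (1 × t_σ)^*𝒫)` of the memo are isomorphic along `t_σ`.)
* §3 **`unitHatSlice_reOrigin`**: the slice `A × {ε_{Â_σ}}` of the re-origined pair IS the slice `A × {σ}` of `D`, so
  `N_{D.reOrigin σ} ≅ (1_A × σ)^*𝒫` (`nonempty_pullback_unitHatSlice_reOrigin_iso`).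
* §4 NON-TRIVIALITY via `universal`'s uniqueness (★ `eq_classify`, ★ `trivialBundle`): if `N_{D.reOrigin σ} ≅ 𝒪` then `σ`
  classifies the trivial family (`left_eq_classify_of_nonempty_unitHatSlice_reOrigin_iso`); hence for a NORMALISED `D`
  (`N_D ≅ 𝒪`, the binder `hD` of ★ `AbelianSchemeDualTransport`) and ANY section `σ ≠ ε_Â`, **`D.reOrigin σ` is a `DualPair` of
  `A` that is NOT normalised** (`not_nonempty_unitHatSlice_reOrigin_iso`, `exists_dualPair_not_normalised`).  So every test
  object of ★ `SiegelFineModuliScheme.classify` / `SiegelFramedCovariant.represents` built on `DualPair` may carry `N ≇ 𝒪` as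
  soon as `Â(S) ≠ {ε}` (a non-zero `K`-point over `Spec K`, a non-zero tangent vector over `Spec K[ε]`); the memo's emptiness
  chain §2(c) for `g ≥ 1` stays a paper argument (s254′ (ii)).  REGRESSION GUARD for the repair of record (R2⁺, director
  s259/s260: a `hatNormalised` clause on polarised triples): the pair of `exists_dualPair_not_normalised` must violate the added
  clause — it does, by `eq_one_of_nonempty_unitHatSlice_reOrigin_iso`.

HC_CM is proved only modulo the 7 printed citations until rung 0 closes; nothing here is about HC.

## References
* [MilneAV2008] J. S. Milne, *Abelian Varieties* (v2.00, 2008), I §8 pp. 36–37 (the dual as a universal pair, both rigidifications).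
* [MumfordFogartyKirwan1994] D. Mumford, J. Fogarty, F. Kirwan, *Geometric Invariant Theory*, 3rd ed. (1994), Ch. 6 §1
  Definition 6.1 (p. 115), Ch. 6 §2 (p. 121) (the normalised Poincaré sheaf), Ch. 7 §2 Def. 7.2–7.3 (p. 129).
* [GortzWedhorn2023] U. Görtz, T. Wedhorn, *Algebraic Geometry II* (2023), Def./Rem. 27.1 (p. 604) (translations by sections).
-/

noncomputable section

-- `Scheme.Modules` / the `Over`-monoidal carriers are not reducible (as in ★ `AbelianSchemeDualTransport`).
set_option backward.isDefEq.respectTransparency false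

universe u

open CategoryTheory CategoryTheory.Limits AlgebraicGeometry MonoidalCategory

namespace Literature.AlgebraicGeometry.AbelianSchemes

namespace AbelianSchemeOver

open Literature.AlgebraicGeometry.Motives Literature.AlgebraicGeometry.Modules
open scoped MonObj

variable {S : Scheme.{u}}

/-! ## §1 Re-origining an abelian scheme at a section -/

/-- **The abelian scheme `B → S` re-origined at the section `σ`**: the same `S`-scheme with the group law transported along
the translation `t_σ : B ≅ B` (Mathlib `GrpObj.ofIso`), i.e. `x ∗ y := σ⁻¹·x·y`-style conjugate law whose unit section is `σ`;
proper, smooth, with geometrically connected fibres because the structure map is unchanged.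
[cite: GortzWedhorn2023, Def./Rem. 27.1 (p. 604)] [cite: MumfordFogartyKirwan1994, Ch. 6 §1 Definition 6.1 (p. 115)] -/
def reOrigin (B : AbelianSchemeOver S) (σ : B.Sections) : AbelianSchemeOver S where
  X := B.X
  grpObj := GrpObj.ofIso (B.translationIso σ)
  isProper := B.isProper
  isSmooth := B.isSmooth
  geometricallyConnected := B.geometricallyConnected

variable (B : AbelianSchemeOver S) (σ : B.Sections)

/-- The underlying `S`-scheme is unchanged. [cite: GortzWedhorn2023, Def./Rem. 27.1 (p. 604)] -/
theorem reOrigin_X : (B.reOrigin σ).X = B.X := rfl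

/-- The unit of the re-origined group law is `η ≫ t_σ`. [cite: GortzWedhorn2023, Def./Rem. 27.1 (p. 604)] -/
theorem reOrigin_one : η[(B.reOrigin σ).X] = (η[B.X] ≫ B.translation σ : 𝟙_ (Over S) ⟶ B.X) :=
  MonObj.ofIso_one (B.translationIso σ)

/-- **The unit section of `B` re-origined at `σ` is `σ`.** [cite: GortzWedhorn2023, Def./Rem. 27.1 (p. 604)] -/
theorem reOrigin_one_eq : η[(B.reOrigin σ).X] = (σ : 𝟙_ (Over S) ⟶ B.X) := by
  rw [reOrigin_one, MonObj.one_eq_one, one_comp_translation]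

/-- The unit section of the re-origined abelian scheme, as a morphism of schemes, is `σ`.
[cite: GortzWedhorn2023, Def./Rem. 27.1 (p. 604)] -/
theorem reOrigin_unitSection : (B.reOrigin σ).unitSection = σ.left :=
  congrArg CommaMorphism.left (B.reOrigin_one_eq σ)

/-- The slice `A × {σ} : A → A ×_S B`, `a ↦ (a, σ(π a))`, through a section `σ` of `B` (for `σ = ε_B` this is ★ `unitHatSlice`).
[cite: MilneAV2008, I §8 pp. 36–37] -/
def sectionSlice (A B : AbelianSchemeOver S) (σ : B.Sections) : A.X.left ⟶ A.prodLeft B :=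
  pullback.lift (𝟙 _) (A.X.hom ≫ σ.left) (by rw [Category.id_comp, Category.assoc, Over.w σ]; rfl)

/-- First projection of `A × {σ}`. [cite: MilneAV2008, I §8 pp. 36–37] -/
@[reassoc (attr := simp)]
theorem sectionSlice_fst (A B' : AbelianSchemeOver S) (τ : B'.Sections) :
    A.sectionSlice B' τ ≫ pullback.fst A.X.hom B'.X.hom = 𝟙 _ :=
  pullback.lift_fst _ _ _

/-- Second projection of `A × {σ}`. [cite: MilneAV2008, I §8 pp. 36–37] -/
@[reassoc (attr := simp)]
theorem sectionSlice_snd (A B' : AbelianSchemeOver S) (τ : B'.Sections) :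
    A.sectionSlice B' τ ≫ pullback.snd A.X.hom B'.X.hom = A.X.hom ≫ τ.left :=
  pullback.lift_snd _ _ _

namespace DualPair

variable {A : AbelianSchemeOver S} (D : A.DualPair) (σ : D.hat.Sections)

/-! ## §2 The re-origined dual pair: ALL FOUR `Prop` fields are `D`'s own -/

/-- **FINDING 8aea22b3 in the kernel: `(Â_σ, 𝒫)` is again a `DualPair` of `A`, for EVERY section `σ` of `Â`.**  The data:
the dual re-origined at `σ` and the SAME Poincaré module; the four propositional fields `hasRank_one`, `rigid` (along
`ε_A × 1` only), `fibrewisePicZero` (geometric points of `Â`) and `universal` (`∃!` on the MORPHISM `T → Â`) are literally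
those of `D` — none of them reads the group law of `hat`. [cite: MilneAV2008, I §8 pp. 36–37]
[cite: MumfordFogartyKirwan1994, Ch. 6 §2 (p. 121)] -/
def reOrigin : A.DualPair where
  hat := D.hat.reOrigin σ
  P := D.P
  hasRank_one := D.hasRank_one
  rigid := D.rigid
  fibrewisePicZero := D.fibrewisePicZero
  universal := D.universal

/-- The dual of the re-origined pair is `Â` re-origined at `σ`. [cite: MilneAV2008, I §8 pp. 36–37] -/
theorem reOrigin_hat : (D.reOrigin σ).hat = D.hat.reOrigin σ := rfl

/-- The Poincaré module of the re-origined pair is `𝒫` itself. [cite: MilneAV2008, I §8 pp. 36–37] -/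
theorem reOrigin_P : (D.reOrigin σ).P = D.P := rfl

/-! ## §3 Its `A × {ε}`-slice is the `A × {σ}`-slice of `D`:  `N_{D.reOrigin σ} ≅ (1_A × σ)^*𝒫` -/

/-- `unitHatSlice` of any dual pair is the slice through its unit section. [cite: MilneAV2008, I §8 pp. 36–37] -/
theorem unitHatSlice_eq_sectionSlice : unitHatSlice D = A.sectionSlice D.hat η[D.hat.X] := by
  apply pullback.hom_ext
  · rw [unitHatSlice_fst, sectionSlice_fst]
  · rw [unitHatSlice_snd, sectionSlice_snd]

/-- **`A × {ε_{Â_σ}} = A × {σ}`**: the unit-hat slice of the re-origined pair is the `σ`-slice of `D`.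
[cite: MilneAV2008, I §8 pp. 36–37] -/
theorem unitHatSlice_reOrigin : unitHatSlice (D.reOrigin σ) = A.sectionSlice D.hat σ := by
  apply pullback.hom_ext
  · rw [unitHatSlice_fst]; exact (sectionSlice_fst A D.hat σ).symm
  · rw [unitHatSlice_snd]
    change A.X.hom ≫ (D.hat.reOrigin σ).unitSection = _
    rw [reOrigin_unitSection]
    exact (sectionSlice_snd A D.hat σ).symm

/-- **`N_{D.reOrigin σ} ≅ (1_A × σ)^*𝒫`** (the theorem `translate_unitHatSlice` of director s254′ (ii)).
[cite: MilneAV2008, I §8 pp. 36–37] [cite: MumfordFogartyKirwan1994, Ch. 6 §2 (p. 121)] -/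
theorem nonempty_pullback_unitHatSlice_reOrigin_iso :
    Nonempty ((Scheme.Modules.pullback (unitHatSlice (D.reOrigin σ))).obj (D.reOrigin σ).P ≅
      (Scheme.Modules.pullback (A.sectionSlice D.hat σ)).obj D.P) :=
  ⟨(Scheme.Modules.pullbackCongr (D.unitHatSlice_reOrigin σ)).app D.P⟩

/-! ## §4 Non-triviality from `universal`'s uniqueness -/

/-- `1_A × σ = (A_S → A) ≫ (A × {σ})` (generalises ★ `baseChangeToProd_unitSection`). [cite: MilneAV2008, I §8 pp. 36–37] -/
theorem baseChangeToProd_section :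
    A.baseChangeToProd D.hat (𝟙 S) σ.left (Over.w σ) = pullback.fst A.X.hom (𝟙 S) ≫ A.sectionSlice D.hat σ := by
  have hcond : pullback.fst A.X.hom (𝟙 S) ≫ A.X.hom = pullback.snd A.X.hom (𝟙 S) ≫ 𝟙 S := pullback.condition
  apply pullback.hom_ext
  · rw [baseChangeToProd_fst, Category.assoc, sectionSlice_fst, Category.comp_id]
  · rw [baseChangeToProd_snd, Category.assoc, sectionSlice_snd, ← Category.assoc, hcond, Category.comp_id]

/-- If the `σ`-slice of `𝒫` is trivial on `A`, then `(1_A × σ)^*𝒫 ≅ 𝒪` on `A_S` (generalises ★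
`nonempty_pullbackP_unitSection_iso`). [cite: MilneAV2008, I §8 pp. 36–37] -/
theorem nonempty_pullbackP_section_iso
    (h : Nonempty ((Scheme.Modules.pullback (A.sectionSlice D.hat σ)).obj D.P ≅ SheafOfModules.unit _)) :
    Nonempty (D.pullbackP (𝟙 S) σ.left (Over.w σ) ≅ (trivialBundle A).L) := by
  obtain ⟨i⟩ := h
  have hI : IsIso (SheafOfModules.pullbackObjUnitToUnit (pullback.fst A.X.hom (𝟙 S)).toRingCatSheafHom) := by
    haveI := Literature.AlgebraicGeometry.KTheory.final_opensMap (pullback.fst A.X.hom (𝟙 S))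
    exact SheafOfModules.instIsIsoPullbackObjUnitToUnitOfFinal _
  exact ⟨(Scheme.Modules.pullbackCongr (D.baseChangeToProd_section σ)).app D.P ≪≫
    ((Scheme.Modules.pullbackComp _ _).app D.P).symm ≪≫ (Scheme.Modules.pullback _).mapIso i ≪≫
    @asIso _ _ _ _ (SheafOfModules.pullbackObjUnitToUnit (pullback.fst A.X.hom (𝟙 S)).toRingCatSheafHom) hI⟩

/-- **If the re-origined pair is normalised, `σ` classifies the trivial family** (`universal`'s UNIQUENESS, ★ `eq_classify`).
[cite: MilneAV2008, I §8 pp. 36–37] -/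
theorem left_eq_classify_of_nonempty_unitHatSlice_reOrigin_iso
    (h : Nonempty ((Scheme.Modules.pullback (unitHatSlice (D.reOrigin σ))).obj (D.reOrigin σ).P ≅ SheafOfModules.unit _)) :
    σ.left = D.classify (𝟙 S) (trivialBundle A) (trivialBundle_fibrewisePicZero A) := by
  have h' : Nonempty ((Scheme.Modules.pullback (A.sectionSlice D.hat σ)).obj D.P ≅ SheafOfModules.unit _) :=
    h.map fun i => ((Scheme.Modules.pullbackCongr (D.unitHatSlice_reOrigin σ)).app D.P).symm ≪≫ i
  exact D.eq_classify (𝟙 S) (trivialBundle A) (trivialBundle_fibrewisePicZero A) σ.left (Over.w σ)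
    (D.nonempty_pullbackP_section_iso σ h')

/-- **If `D` is normalised and its re-origined pair at `σ` is normalised too, then `σ = ε_Â`** (both classify the trivial
family; ★ `eq_of_nonempty_iso`). [cite: MilneAV2008, I §8 pp. 36–37] [cite: MumfordFogartyKirwan1994, Ch. 6 §2 (p. 121)] -/
theorem eq_one_of_nonempty_unitHatSlice_reOrigin_iso
    (hD : Nonempty ((Scheme.Modules.pullback (unitHatSlice D)).obj D.P ≅ SheafOfModules.unit _))
    (h : Nonempty ((Scheme.Modules.pullback (unitHatSlice (D.reOrigin σ))).obj (D.reOrigin σ).P ≅ SheafOfModules.unit _)) :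
    σ = η[D.hat.X] := by
  have h' : Nonempty ((Scheme.Modules.pullback (A.sectionSlice D.hat σ)).obj D.P ≅ SheafOfModules.unit _) :=
    h.map fun i => ((Scheme.Modules.pullbackCongr (D.unitHatSlice_reOrigin σ)).app D.P).symm ≪≫ i
  apply Over.OverMorphism.ext
  exact D.eq_of_nonempty_iso (𝟙 S) (trivialBundle A) (trivialBundle_fibrewisePicZero A) σ.left D.hat.unitSection
    (Over.w σ) D.hat.unitSection_comp_hom (D.nonempty_pullbackP_section_iso σ h') (D.nonempty_pullbackP_unitSection_iso hD)

/-- **(V3) HEADLINE — a normalised dual pair re-origined at `σ ≠ ε_Â` is a `DualPair` of `A` that is NOT normalised:**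
the structure `DualPair` does not pin `(1_A × ε_Â)^*𝒫 ≅ 𝒪` (FINDING 8aea22b3, class «refuted-misstated» at the letter).
[cite: MilneAV2008, I §8 pp. 36–37] [cite: MumfordFogartyKirwan1994, Ch. 6 §2 (p. 121)] -/
theorem not_nonempty_unitHatSlice_reOrigin_iso
    (hD : Nonempty ((Scheme.Modules.pullback (unitHatSlice D)).obj D.P ≅ SheafOfModules.unit _)) (hσ : σ ≠ η[D.hat.X]) :
    ¬ Nonempty ((Scheme.Modules.pullback (unitHatSlice (D.reOrigin σ))).obj (D.reOrigin σ).P ≅ SheafOfModules.unit _) :=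
  fun h => hσ (D.eq_one_of_nonempty_unitHatSlice_reOrigin_iso σ hD h)

/-- The same, as an existence statement: every dual pair whose dual has a section `σ ≠ ε_Â` (after normalising, ★
`DualPair.normalize` keeps `hat`) yields a NON-normalised dual pair of the same `A` with the same `hat`-scheme.
[cite: MilneAV2008, I §8 pp. 36–37] -/
theorem exists_dualPair_not_normalised
    (hD : Nonempty ((Scheme.Modules.pullback (unitHatSlice D)).obj D.P ≅ SheafOfModules.unit _)) (hσ : σ ≠ η[D.hat.X]) :
    ∃ D' : A.DualPair, D'.hat.X = D.hat.X ∧ D'.P ≍ D.P ∧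
      ¬ Nonempty ((Scheme.Modules.pullback (unitHatSlice D')).obj D'.P ≅ SheafOfModules.unit _) :=
  ⟨D.reOrigin σ, rfl, HEq.rfl, D.not_nonempty_unitHatSlice_reOrigin_iso σ hD hσ⟩

end DualPair

end AbelianSchemeOver

end Literature.AlgebraicGeometry.AbelianSchemes

end
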